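import Summits.QuantumFields.YangMills.Theorems.FemtoTransferGapMultiplierIMS
import Summits.QuantumFields.YangMills.Theorems.FlatTubeReductionOffTubeSuppressionPrelim
import Summits.QuantumFields.YangMills.Theorems.FemtoCutoffLadderDyadicNestedUpperPullback
import HarnessLib

/-!
# The ground-state Dirichlet form bounds the femto transfer gap from above (variational UPPER direction)
# (crux `DyadicNestedUpper` stmt-QuantumFields-25766 of route `FemtoCutoffLadder`, LINE 1 of seat ym-idea-1 g4 — «ONE block-constant trial function
# … in the fine ground-state Dirichlet form ½∫∫K_βΩΩ(f(U)−f(V))²»; rung R2b1 = RECORD-label femto gap; seat ym-line-sfw-p1 g10)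

For the zero-flux `SU(2)` transfer form on `(ℤ/L)³`: let `Ω` be a positive normalised exact ground state (`K_βΩ = λ₀Ω`, `‖Ω‖ = 1`,
`exists_groundState`) and `g` a bounded measurable gauge- and twist-invariant multiplier with ground-state variance
`Var_Ω(g) = ∫g²Ω² − (∫gΩ²)² > 0`.  Then (★ `topValue_sub_dirichlet_le_secondValue`)

  `λ₁ ≥ λ₀ − ℰ_Ω(g) / Var_Ω(g)`,   `ℰ_Ω(g) = ½ ∫∫ Ω(U) K_β(U,V) Ω(V) (g(U) − g(V))² d(μ⊗μ)`,

i.e. the femto excitation energy `−log(λ₁/λ₀)` is bounded above through ONE trial multiplier in the ground-state (Doob) Dirichlet form — the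
min–max principle on the two-dimensional space `{(a + b·g)Ω}` combined with the tree's product identity
`⟨gη, K_β gη⟩ = ⟨g²η, K_βη⟩ − ½∫∫ ηKη (g(U) − g(V))²` (`energy_mul_eq_su2`): `⟨ψ,Kψ⟩ = λ₀‖ψ‖² − b²ℰ_Ω(g)` and `‖ψ‖² ≥ b²·Var_Ω(g)` for
`ψ = (a + bg)Ω`.  With `g = g' ∘ B_M` the pull-back of a COARSE invariant multiplier along the block link map
(`…DyadicNestedUpperPullback.lean`: invariance is preserved) this is exactly the trial-function step of 25766; what it leaves open is the
renormalisation-group comparison of `ℰ_{Ω_fine}(g'∘B_M)/Var` with the coarse excitation energy (the crux proper, L–XL).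

HONEST FRAMING: fixed-lattice variational bookkeeping (any `L`, any `β`); no two-cutoff statement is proved; R2b1 is a RECORD rung — nothing here
concerns infinite volume, the continuum, or the Clay Yang–Mills mass gap.  No definitions, no named facts, no `sorry`.
References: Reed–Simon IV, Thm. XIII.1–2 [cite: ReedSimonIV1978, Thm. XIII.1]; B. Simon, Ann. Phys. 146 (1983) 209, §3 (ground-state
transformation) [cite: SimonB1983DiscreteSpectrum, §3].
-/

set_option autoImplicit false

noncomputable section

open MeasureTheory Filter Topology Real
open Literature.MathematicalPhysics.QuantumFieldTheory
open Literature.MathematicalPhysics.QuantumLattice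

namespace Summit.QuantumFields.YangMills.Theorems.FemtoTransferGap

namespace Dirichlet

open OffTube

variable {L : ℕ} [NeZero L]

omit [NeZero L] in
/-- The affine multiplier `a + b·g` inherits measurability, boundedness and invariance from `g`. [folklore] -/
theorem affine_multiplier {g : GaugeConfig 3 L SU2 → ℝ} (hgm : Measurable g) {Cg : ℝ} (hgb : ∀ U, |g U| ≤ Cg)
    (hgg : ∀ (k : Site 3 L → SU2) (U : GaugeConfig 3 L SU2), g (gaugeTransform k U) = g U)
    (hgz : ∀ (k : Fin 3), ∀ z ∈ Subgroup.center SU2, ∀ U : GaugeConfig 3 L SU2, g (twist k z U) = g U) (a b : ℝ) :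
    Measurable (fun U => a + b * g U) ∧ (∀ U, |a + b * g U| ≤ |a| + |b| * Cg) ∧
      (∀ (k : Site 3 L → SU2) (U : GaugeConfig 3 L SU2), a + b * g (gaugeTransform k U) = a + b * g U) ∧
      (∀ (k : Fin 3), ∀ z ∈ Subgroup.center SU2, ∀ U : GaugeConfig 3 L SU2, a + b * g (twist k z U) = a + b * g U) := by
  refine ⟨measurable_const.add (hgm.const_mul b), fun U => ?_, fun k U => by rw [hgg], fun k z hz U => by rw [hgz k z hz]⟩
  calc |a + b * g U| ≤ |a| + |b * g U| := abs_add_le _ _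
    _ = |a| + |b| * |g U| := by rw [abs_mul]
    _ ≤ |a| + |b| * Cg := by nlinarith [hgb U, abs_nonneg b, abs_nonneg (g U)]

/-- ★ **Energy of the trial state `ψ = (a + bg)Ω`**: `⟨ψ, K_βψ⟩ = λ₀‖ψ‖² − b²·ℰ_Ω(g)` for an exact eigenfunction `K_βΩ = λ₀Ω` and an invariant
bounded multiplier `g` (the tree's product identity `energy_mul_eq_su2` with the affine multiplier `a + bg`). [cite: SimonB1983DiscreteSpectrum, §3] -/
theorem qform_affine_mul_eigen (β : ℝ) {g : GaugeConfig 3 L SU2 → ℝ} (hgm : Measurable g) {Cg : ℝ} (hgb : ∀ U, |g U| ≤ Cg)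
    (hgg : ∀ (k : Site 3 L → SU2) (U : GaugeConfig 3 L SU2), g (gaugeTransform k U) = g U)
    (hgz : ∀ (k : Fin 3), ∀ z ∈ Subgroup.center SU2, ∀ U : GaugeConfig 3 L SU2, g (twist k z U) = g U)
    {Ω : GaugeConfig 3 L SU2 → ℝ} (hΩ : IsPhys Ω) {lam : ℝ} (heig : transferApply β Ω = lam • Ω) (a b : ℝ) :
    qform su2Rep β (fun U => (a + b * g U) * Ω U) (fun U => (a + b * g U) * Ω U) =
      lam * l2 (fun U => (a + b * g U) * Ω U) (fun U => (a + b * g U) * Ω U) -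
        b ^ 2 * ((1 / 2) * ∫ p, Ω p.1 * transferKernel su2Rep β p.1 p.2 * Ω p.2 * (g p.1 - g p.2) ^ 2
          ∂(configMeasure SU2 L).prod (configMeasure SU2 L)) := by
  obtain ⟨hm, hb, hg', hz'⟩ := affine_multiplier hgm hgb hgg hgz a b
  have h := energy_mul_eq_su2 (L := L) β hm hb hg' hz' hΩ lam
  -- the first bracket vanishes on an exact eigenfunction
  have h0 : lam * l2 (fun U => (a + b * g U) ^ 2 * Ω U) Ω - l2 (fun U => (a + b * g U) ^ 2 * Ω U) (transferApply β Ω) = 0 := by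
    rw [heig, l2_comm _ (lam • Ω), l2_smul_left, l2_comm Ω]; ring
  -- the second bracket scales by `b²`
  have h2 : ∫ p, Ω p.1 * transferKernel su2Rep β p.1 p.2 * Ω p.2 * ((a + b * g p.1) - (a + b * g p.2)) ^ 2
        ∂(configMeasure SU2 L).prod (configMeasure SU2 L)
      = b ^ 2 * ∫ p, Ω p.1 * transferKernel su2Rep β p.1 p.2 * Ω p.2 * (g p.1 - g p.2) ^ 2
        ∂(configMeasure SU2 L).prod (configMeasure SU2 L) := by
    rw [← integral_const_mul]
    refine integral_congr_ae (ae_of_all _ fun p => ?_)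
    ring
  rw [h0, h2, zero_add] at h
  linarith

/-- `‖(a + bg)Ω‖² = a²‖Ω‖² + 2ab⟨gΩ,Ω⟩ + b²‖gΩ‖²`. [folklore] -/
theorem l2_affine_mul {g Ω : GaugeConfig 3 L SU2 → ℝ} (hgΩ : IsPhys (fun U => g U * Ω U)) (hΩ : IsPhys Ω) (a b : ℝ) :
    l2 (fun U => (a + b * g U) * Ω U) (fun U => (a + b * g U) * Ω U) =
      a ^ 2 * l2 Ω Ω + 2 * (a * b) * l2 (fun U => g U * Ω U) Ω + b ^ 2 * l2 (fun U => g U * Ω U) (fun U => g U * Ω U) := by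
  have hfun : (fun U => (a + b * g U) * Ω U) = a • Ω + b • (fun U => g U * Ω U) := by
    funext U; simp only [Pi.add_apply, Pi.smul_apply, smul_eq_mul]; ring
  rw [hfun, l2_add_add (hΩ.smul a) (hgΩ.smul b), l2_smul_left, l2_comm Ω (a • Ω), l2_smul_left, l2_smul_left,
    l2_comm Ω (b • _), l2_smul_left, l2_smul_left, l2_comm (fun U => g U * Ω U) (b • _), l2_smul_left]
  ring

/-- ★★ **The ground-state Dirichlet form bounds the gap from above.**  `Ω` a positive normalised exact ground state of the zero-flux `SU(2)`
transfer operator (`K_βΩ = λ₀Ω`, `‖Ω‖² = 1`), `g` a bounded measurable gauge- and twist-invariant multiplier with ground-state variance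
`Var = ‖gΩ‖² − ⟨gΩ,Ω⟩² > 0`.  Then `λ₀ − ℰ_Ω(g)/Var ≤ λ₁`, `ℰ_Ω(g) = ½∫∫ Ω(U)K_β(U,V)Ω(V)(g(U) − g(V))²`: for every constraint `φ` the plane
`{(a + bg)Ω}` contains a non-zero vector orthogonal to `φ`, whose Rayleigh quotient is `λ₀ − b²ℰ/‖ψ‖² ≥ λ₀ − ℰ/Var` since `‖ψ‖² ≥ b²·Var`.
[cite: ReedSimonIV1978, Thm. XIII.1] [cite: SimonB1983DiscreteSpectrum, §3] -/
theorem topValue_sub_dirichlet_le_secondValue (β : ℝ) {g : GaugeConfig 3 L SU2 → ℝ} (hgm : Measurable g) {Cg : ℝ}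
    (hgb : ∀ U, |g U| ≤ Cg)
    (hgg : ∀ (k : Site 3 L → SU2) (U : GaugeConfig 3 L SU2), g (gaugeTransform k U) = g U)
    (hgz : ∀ (k : Fin 3), ∀ z ∈ Subgroup.center SU2, ∀ U : GaugeConfig 3 L SU2, g (twist k z U) = g U)
    {Ω : GaugeConfig 3 L SU2 → ℝ} (hΩ : IsPhys Ω) (hpos : ∀ U, 0 < Ω U) (hn : l2 Ω Ω = 1)
    (heig : transferApply β Ω = topValue su2Rep L β • Ω)
    (hVar : 0 < l2 (fun U => g U * Ω U) (fun U => g U * Ω U) - l2 (fun U => g U * Ω U) Ω ^ 2) :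
    topValue su2Rep L β -
        ((1 / 2) * ∫ p, Ω p.1 * transferKernel su2Rep β p.1 p.2 * Ω p.2 * (g p.1 - g p.2) ^ 2
          ∂(configMeasure SU2 L).prod (configMeasure SU2 L)) /
        (l2 (fun U => g U * Ω U) (fun U => g U * Ω U) - l2 (fun U => g U * Ω U) Ω ^ 2)
      ≤ secondValue su2Rep L β := by
  set lam₀ := topValue su2Rep L β with hlam₀
  set E := (1 / 2) * ∫ p, Ω p.1 * transferKernel su2Rep β p.1 p.2 * Ω p.2 * (g p.1 - g p.2) ^ 2
    ∂(configMeasure SU2 L).prod (configMeasure SU2 L) with hE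
  set m₁ := l2 (fun U => g U * Ω U) Ω with hm₁
  set m₂ := l2 (fun U => g U * Ω U) (fun U => g U * Ω U) with hm₂
  set V := m₂ - m₁ ^ 2 with hV
  have hgΩ : IsPhys (fun U => g U * Ω U) := hΩ.mul_of_invariant hgm hgb hgg hgz
  have hE0 : 0 ≤ E := by
    rw [hE]
    refine mul_nonneg (by norm_num) (integral_nonneg fun p => ?_)
    have h1 := (hpos p.1).le; have h2 := (hpos p.2).le
    have hK := (transferKernel_pos su2Rep β p.1 p.2).le
    positivity
  -- every trial state `(a + bg)Ω` with `(a,b) ≠ 0` is admissible with Rayleigh quotient `≥ λ₀ − E/V`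
  have htrial : ∀ a b : ℝ, a ^ 2 + b ^ 2 ≠ 0 →
      0 < l2 (fun U => (a + b * g U) * Ω U) (fun U => (a + b * g U) * Ω U) ∧
        (lam₀ - E / V) * l2 (fun U => (a + b * g U) * Ω U) (fun U => (a + b * g U) * Ω U) ≤
          qform su2Rep β (fun U => (a + b * g U) * Ω U) (fun U => (a + b * g U) * Ω U) := by
    intro a b hab
    have hnorm := l2_affine_mul hgΩ hΩ a b
    rw [hn, mul_one, ← hm₁, ← hm₂] at hnorm
    -- `‖ψ‖² = (a + b m₁)² + b² V ≥ b² V`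
    have hlow : b ^ 2 * V ≤ l2 (fun U => (a + b * g U) * Ω U) (fun U => (a + b * g U) * Ω U) := by
      rw [hnorm, hV]; nlinarith [sq_nonneg (a + b * m₁)]
    have hposψ : 0 < l2 (fun U => (a + b * g U) * Ω U) (fun U => (a + b * g U) * Ω U) := by
      by_cases hb : b = 0
      · have ha : a ≠ 0 := by
          intro ha; apply hab; rw [ha, hb]; ring
        rw [hnorm, hb]; simp only [mul_zero, zero_mul, add_zero, sq]
        nlinarith [sq_nonneg a, mul_self_pos.2 ha]
      · exact lt_of_lt_of_le (mul_pos (by positivity) hVar) hlow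
    refine ⟨hposψ, ?_⟩
    rw [qform_affine_mul_eigen β hgm hgb hgg hgz hΩ heig a b, ← hE, sub_mul, div_mul_eq_mul_div]
    -- `b² E ≤ E ‖ψ‖² / V`
    have h1 : b ^ 2 * E ≤ E * l2 (fun U => (a + b * g U) * Ω U) (fun U => (a + b * g U) * Ω U) / V := by
      rw [le_div_iff₀ hVar]
      calc b ^ 2 * E * V = E * (b ^ 2 * V) := by ring
        _ ≤ E * l2 (fun U => (a + b * g U) * Ω U) (fun U => (a + b * g U) * Ω U) := mul_le_mul_of_nonneg_left hlow hE0
    linarith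
  -- min–max: for each constraint pick `(a,b) ⊥ φ`
  unfold secondValue
  refine le_csInf ⟨_, fun _ => 1, isPhys_const 1, rfl⟩ ?_
  rintro s ⟨φ, hφ, rfl⟩
  set p := l2 Ω φ with hp
  set q := l2 (fun U => g U * Ω U) φ with hq
  obtain ⟨a, b, hab, hzero⟩ : ∃ a b : ℝ, a ^ 2 + b ^ 2 ≠ 0 ∧ a * p + b * q = 0 := by
    by_cases h : p ^ 2 + q ^ 2 = 0
    · have hp0 : p = 0 := by nlinarith [sq_nonneg p, sq_nonneg q]
      have hq0 : q = 0 := by nlinarith [sq_nonneg p, sq_nonneg q]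
      exact ⟨1, 0, by norm_num, by rw [hp0, hq0]; ring⟩
    · exact ⟨q, -p, by rwa [neg_sq, add_comm], by ring⟩
  obtain ⟨hposψ, hray⟩ := htrial a b hab
  obtain ⟨hm, hb', hg', hz'⟩ := affine_multiplier hgm hgb hgg hgz a b
  have hψ : IsPhys (fun U => (a + b * g U) * Ω U) := hΩ.mul_of_invariant hm hb' hg' hz'
  have horth : l2 (fun U => (a + b * g U) * Ω U) φ = 0 := by
    have hfun : (fun U => (a + b * g U) * Ω U) = a • Ω + b • (fun U => g U * Ω U) := by
      funext U; simp only [Pi.add_apply, Pi.smul_apply, smul_eq_mul]; ring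
    rw [hfun, l2_add_left (hΩ.smul a) (hgΩ.smul b) hφ, l2_smul_left, l2_smul_left, ← hp, ← hq, hzero]
  have hmem : qform su2Rep β (fun U => (a + b * g U) * Ω U) (fun U => (a + b * g U) * Ω U) /
      l2 (fun U => (a + b * g U) * Ω U) (fun U => (a + b * g U) * Ω U) ∈ rayleighSet su2Rep L β (fun ψ => l2 ψ φ = 0) :=
    ⟨_, hψ, horth, hposψ, rfl⟩
  exact ((le_div_iff₀ hposψ).2 hray).trans (le_csSup (bddAbove_rayleighSet_su2Rep L β _) hmem)

/-- ★★ The same with the tree's existential ground state supplied: for every bounded measurable invariant multiplier `g` there is a positive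
normalised exact ground state `Ω` (`exists_groundState`); if `Var_Ω(g) > 0` then `λ₀ − ℰ_Ω(g)/Var_Ω(g) ≤ λ₁`.  Stated as: for every `β` there is
`Ω` (physical, positive, normalised, `K_βΩ = λ₀Ω`) such that the bound holds for ALL admissible `g`. [cite: ReedSimonIV1978, Thm. XIII.1] -/
theorem exists_groundState_dirichlet_bound (β : ℝ) :
    ∃ Ω : GaugeConfig 3 L SU2 → ℝ, IsPhys Ω ∧ (∀ U, 0 < Ω U) ∧ l2 Ω Ω = 1 ∧ transferApply β Ω = topValue su2Rep L β • Ω ∧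
      ∀ (g : GaugeConfig 3 L SU2 → ℝ), Measurable g → (∃ Cg : ℝ, ∀ U, |g U| ≤ Cg) →
        (∀ (k : Site 3 L → SU2) (U : GaugeConfig 3 L SU2), g (gaugeTransform k U) = g U) →
        (∀ (k : Fin 3), ∀ z ∈ Subgroup.center SU2, ∀ U : GaugeConfig 3 L SU2, g (twist k z U) = g U) →
        0 < l2 (fun U => g U * Ω U) (fun U => g U * Ω U) - l2 (fun U => g U * Ω U) Ω ^ 2 →
        topValue su2Rep L β -
            ((1 / 2) * ∫ p, Ω p.1 * transferKernel su2Rep β p.1 p.2 * Ω p.2 * (g p.1 - g p.2) ^ 2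
              ∂(configMeasure SU2 L).prod (configMeasure SU2 L)) /
            (l2 (fun U => g U * Ω U) (fun U => g U * Ω U) - l2 (fun U => g U * Ω U) Ω ^ 2)
          ≤ secondValue su2Rep L β := by
  obtain ⟨Ω, θ, c, hΩ, hc, hcle, hn, heig, -, -, -⟩ := PhysL2.exists_groundState (L := L) β
  refine ⟨Ω, hΩ, fun U => hc.trans_le (hcle U), hn, heig, fun g hgm ⟨Cg, hgb⟩ hgg hgz hVar => ?_⟩
  exact topValue_sub_dirichlet_le_secondValue β hgm hgb hgg hgz hΩ (fun U => hc.trans_le (hcle U)) hn heig hVar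

/-! ## §2 The pulled-back coarse multiplier as a fine trial function (the trial-function step of `DyadicNestedUpper`) -/

/-- A bounded measurable gauge- and twist-invariant COARSE multiplier `g'` pulls back along the block link map `B_M` to a bounded measurable gauge-
and twist-invariant FINE multiplier (`blockLink_gaugeTransform`, `blockLink_twist`, `continuous_blockLink`). [cite: Balaban1985Averaging] -/
theorem pullback_multiplier {M L' : ℕ} [NeZero M] [NeZero L'] {g' : GaugeConfig 3 L' SU2 → ℝ} (hgm : Measurable g') {Cg : ℝ}
    (hgb : ∀ V, |g' V| ≤ Cg)
    (hgg : ∀ (k : Site 3 L' → SU2) (V : GaugeConfig 3 L' SU2), g' (gaugeTransform k V) = g' V)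
    (hgz : ∀ (k : Fin 3), ∀ z ∈ Subgroup.center SU2, ∀ V : GaugeConfig 3 L' SU2, g' (twist k z V) = g' V) :
    Measurable (fun U : GaugeConfig 3 (M * L') SU2 =>
        g' (fun e : Edge 3 L' => transport U (torusBlockCorner M L' e.1) (List.replicate M e.2))) ∧
      (∀ U : GaugeConfig 3 (M * L') SU2,
        |g' (fun e : Edge 3 L' => transport U (torusBlockCorner M L' e.1) (List.replicate M e.2))| ≤ Cg) ∧
      (∀ (k : Site 3 (M * L') → SU2) (U : GaugeConfig 3 (M * L') SU2),
        g' (fun e : Edge 3 L' => transport (gaugeTransform k U) (torusBlockCorner M L' e.1) (List.replicate M e.2)) =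
          g' (fun e : Edge 3 L' => transport U (torusBlockCorner M L' e.1) (List.replicate M e.2))) ∧
      (∀ (k : Fin 3), ∀ z ∈ Subgroup.center SU2, ∀ U : GaugeConfig 3 (M * L') SU2,
        g' (fun e : Edge 3 L' => transport (twist k z U) (torusBlockCorner M L' e.1) (List.replicate M e.2)) =
          g' (fun e : Edge 3 L' => transport U (torusBlockCorner M L' e.1) (List.replicate M e.2))) :=
  ⟨hgm.comp BlockPullback.continuous_blockLink.measurable, fun U => hgb _,
    fun k U => by rw [BlockPullback.blockLink_gaugeTransform, hgg],
    fun k z hz U => by rw [BlockPullback.blockLink_twist, hgz k z hz]⟩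

/-- ★★★ **The trial-function step of `DyadicNestedUpper` (25766), kernel-checked.**  On the fine lattice `(ℤ/ML')³` let `Ω` be a positive
normalised exact ground state; for every bounded measurable gauge- and twist-invariant COARSE multiplier `g'` on `(ℤ/L')³` whose pull-back
`g = g' ∘ B_M` has positive ground-state variance,
`λ₀(ML') − ℰ_Ω(g' ∘ B_M) / Var_Ω(g' ∘ B_M) ≤ λ₁(ML')` — the FINE femto gap is bounded above by the fine ground-state Dirichlet form of ONE
block-constant (pulled-back) observable; the intended `g'` is the ratio `φ₁'/φ₀'` of the two top COARSE eigenfunctions.  What remains for 25766 is the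
RG comparison of this quotient with the coarse gap. [cite: ReedSimonIV1978, Thm. XIII.1] [cite: Balaban1985Averaging] -/
theorem fine_gap_le_dirichlet_of_pullback {M L' : ℕ} [NeZero M] [NeZero L'] [NeZero (M * L')] (β : ℝ) {g' : GaugeConfig 3 L' SU2 → ℝ} (hgm : Measurable g')
    {Cg : ℝ} (hgb : ∀ V, |g' V| ≤ Cg)
    (hgg : ∀ (k : Site 3 L' → SU2) (V : GaugeConfig 3 L' SU2), g' (gaugeTransform k V) = g' V)
    (hgz : ∀ (k : Fin 3), ∀ z ∈ Subgroup.center SU2, ∀ V : GaugeConfig 3 L' SU2, g' (twist k z V) = g' V)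
    {Ω : GaugeConfig 3 (M * L') SU2 → ℝ} (hΩ : IsPhys Ω) (hpos : ∀ U, 0 < Ω U) (hn : l2 Ω Ω = 1)
    (heig : transferApply β Ω = topValue su2Rep (M * L') β • Ω)
    (hVar : 0 < l2 (fun U => g' (fun e : Edge 3 L' => transport U (torusBlockCorner M L' e.1) (List.replicate M e.2)) * Ω U)
                   (fun U => g' (fun e : Edge 3 L' => transport U (torusBlockCorner M L' e.1) (List.replicate M e.2)) * Ω U) -
            l2 (fun U => g' (fun e : Edge 3 L' => transport U (torusBlockCorner M L' e.1) (List.replicate M e.2)) * Ω U) Ω ^ 2) :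
    topValue su2Rep (M * L') β -
        ((1 / 2) * ∫ p, Ω p.1 * transferKernel su2Rep β p.1 p.2 * Ω p.2 *
            (g' (fun e : Edge 3 L' => transport p.1 (torusBlockCorner M L' e.1) (List.replicate M e.2)) -
              g' (fun e : Edge 3 L' => transport p.2 (torusBlockCorner M L' e.1) (List.replicate M e.2))) ^ 2
          ∂(configMeasure SU2 (M * L')).prod (configMeasure SU2 (M * L'))) /
        (l2 (fun U => g' (fun e : Edge 3 L' => transport U (torusBlockCorner M L' e.1) (List.replicate M e.2)) * Ω U)
              (fun U => g' (fun e : Edge 3 L' => transport U (torusBlockCorner M L' e.1) (List.replicate M e.2)) * Ω U) -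
          l2 (fun U => g' (fun e : Edge 3 L' => transport U (torusBlockCorner M L' e.1) (List.replicate M e.2)) * Ω U) Ω ^ 2)
      ≤ secondValue su2Rep (M * L') β := by
  obtain ⟨hm, hb, hg, hz⟩ := pullback_multiplier (M := M) (L' := L') hgm hgb hgg hgz
  exact topValue_sub_dirichlet_le_secondValue β hm hb hg hz hΩ hpos hn heig hVar

/-! ## §3 Tightness at the first excited state: the COARSE side of the comparison is exact -/

/-- Exact eigenfunctions of the symmetric transfer operator with DIFFERENT eigenvalues are `l2`-orthogonal. [cite: ReedSimonIV1978, Thm. XIII.1] -/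
theorem l2_eq_zero_of_eigen_ne (β : ℝ) {φ ψ : GaugeConfig 3 L SU2 → ℝ} (hφ : IsPhys φ) (hψ : IsPhys ψ) {lam mu : ℝ}
    (hφe : transferApply β φ = lam • φ) (hψe : transferApply β ψ = mu • ψ) (hne : lam ≠ mu) : l2 φ ψ = 0 := by
  have h1 : l2 (transferApply β φ) ψ = lam * l2 φ ψ := by rw [hφe, l2_smul_left]
  have h2 : l2 φ (transferApply β ψ) = mu * l2 φ ψ := by rw [hψe, l2_comm, l2_smul_left, l2_comm]
  have h := l2_transferApply_comm β hφ hψ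
  rw [h1, h2] at h
  have : (lam - mu) * l2 φ ψ = 0 := by linarith
  rcases mul_eq_zero.1 this with h0 | h0
  · exact absurd (sub_eq_zero.1 h0) hne
  · exact h0

omit [NeZero L] in
/-- **The ratio multiplier `g = φ₁/Ω`** of a physical `φ₁` by a physical ground state `Ω ≥ c > 0` is bounded, measurable, gauge- and twist-invariant,
and `g·Ω = φ₁`. [folklore] -/
theorem ratio_multiplier {Ω φ₁ : GaugeConfig 3 L SU2 → ℝ} (hΩ : IsPhys Ω) (hφ₁ : IsPhys φ₁) {c : ℝ} (hc : 0 < c) (hcle : ∀ U, c ≤ Ω U) :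
    Measurable (fun U => φ₁ U / Ω U) ∧ (∃ Cg : ℝ, ∀ U, |φ₁ U / Ω U| ≤ Cg) ∧
      (∀ (k : Site 3 L → SU2) (U : GaugeConfig 3 L SU2), φ₁ (gaugeTransform k U) / Ω (gaugeTransform k U) = φ₁ U / Ω U) ∧
      (∀ (k : Fin 3), ∀ z ∈ Subgroup.center SU2, ∀ U : GaugeConfig 3 L SU2, φ₁ (twist k z U) / Ω (twist k z U) = φ₁ U / Ω U) ∧
      (fun U => φ₁ U / Ω U * Ω U) = φ₁ := by
  obtain ⟨C₁, hC₁⟩ := hφ₁.bounded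
  refine ⟨hφ₁.measurable.div hΩ.measurable, ⟨C₁ / c, fun U => ?_⟩, fun k U => by rw [hφ₁.gaugeInv, hΩ.gaugeInv],
    fun k z hz U => by rw [hφ₁.zeroFlux k z hz, hΩ.zeroFlux k z hz], funext fun U => div_mul_cancel₀ _ (hc.trans_le (hcle U)).ne'⟩
  have hΩU : 0 < Ω U := hc.trans_le (hcle U)
  rw [abs_div, abs_of_pos hΩU, div_le_div_iff₀ hΩU hc]
  calc |φ₁ U| * c ≤ C₁ * c := mul_le_mul_of_nonneg_right (hC₁ U) hc.le
    _ ≤ C₁ * Ω U := mul_le_mul_of_nonneg_left (hcle U) ((abs_nonneg _).trans (hC₁ U))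

/-- ★★ **Tightness of the Dirichlet bound at the first excited state.**  If `Ω ≥ c > 0` is an exact ground state (`K_βΩ = λ₀Ω`) and `φ₁` a
normalised exact eigenfunction for an eigenvalue `λ₁ ≠ λ₀`, then the ratio multiplier `g = φ₁/Ω` has ground-state variance `Var_Ω(g) = 1` and
Dirichlet energy `ℰ_Ω(g) = λ₀ − λ₁` — so `λ₀ − ℰ_Ω(g)/Var_Ω(g) = λ₁` EXACTLY: on the coarse lattice of `DyadicNestedUpper` the variational bound of §1 is
an identity for the intended trial multiplier. [cite: SimonB1983DiscreteSpectrum, §3] -/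
theorem dirichlet_ratio_exact (β : ℝ) {Ω φ₁ : GaugeConfig 3 L SU2 → ℝ} (hΩ : IsPhys Ω) (hφ₁ : IsPhys φ₁) {c : ℝ} (hc : 0 < c)
    (hcle : ∀ U, c ≤ Ω U) (hn₁ : l2 φ₁ φ₁ = 1) {lam₀ lam₁ : ℝ}
    (heig₀ : transferApply β Ω = lam₀ • Ω) (heig₁ : transferApply β φ₁ = lam₁ • φ₁) (hne : lam₀ ≠ lam₁) :
    l2 (fun U => φ₁ U / Ω U * Ω U) (fun U => φ₁ U / Ω U * Ω U) - l2 (fun U => φ₁ U / Ω U * Ω U) Ω ^ 2 = 1 ∧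
      (1 / 2) * ∫ p, Ω p.1 * transferKernel su2Rep β p.1 p.2 * Ω p.2 * (φ₁ p.1 / Ω p.1 - φ₁ p.2 / Ω p.2) ^ 2
          ∂(configMeasure SU2 L).prod (configMeasure SU2 L) = lam₀ - lam₁ := by
  obtain ⟨hm, ⟨Cg, hb⟩, hg, hz, hgΩ⟩ := ratio_multiplier hΩ hφ₁ hc hcle
  have horth : l2 φ₁ Ω = 0 := l2_eq_zero_of_eigen_ne β hφ₁ hΩ heig₁ heig₀ hne.symm
  refine ⟨by rw [hgΩ, hn₁, horth]; ring, ?_⟩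
  -- energy identity with `a = 0`, `b = 1`
  have h := qform_affine_mul_eigen β hm hb hg hz hΩ heig₀ 0 1
  have h01 : (fun U => (0 + 1 * (φ₁ U / Ω U)) * Ω U) = φ₁ := by
    funext U; rw [zero_add, one_mul]; exact congrFun hgΩ U
  rw [h01, qform_eigen_right β heig₁, hn₁] at h
  linarith

end Dirichlet

end Summit.QuantumFields.YangMills.Theorems.FemtoTransferGap

end
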